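import Literature.NumberTheory.EllipticCurves.KrizLi2019.SexticTwistBSDThreeDescent
import Literature.NumberTheory.EllipticCurves.QuadraticTwistRank
import Summits.BirchSwinnertonDyer.BirchSwinnertonDyer.Theorems.GenusKolyvaginAtTwoPowDvdShaCardAtTwoRTTwoTorsionQuadratic
import HarnessLib

/-!
# GK₂ route `GenusKolyvaginAtTwo`, crux `RankOneShaCellBSDTwo` (stmt-27477), LINE 41 «restriction_rigidity»:
# the REGULATOR TERM of stub ISO₂ — `Reg(E/K) = 2 · Reg(E/F)` in rank one without `2`-torsion

THEOREMS ONLY (no definition, no named fact, no `sorry`; standard axioms).  Nothing about BSD, the crux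
`RankOneShaCellBSDTwo` or any research stub is proved here.  This is the first of the four `2`-adic
bookkeeping lemmas behind LINE 41's print-grade stub ISO₂ `ShaQuadraticBookkeepingAtTwo`
(`#Ш(W_K)[2^∞] = #Ш(W)[2^∞]·#Ш(W^{(d_K)})[2^∞]·2^{Σ_{ℓ∣d_K} i_ℓ + 𝟙[0<Δ_W] − 1}`; the `−1` is the regulator
term `−rank W(K)` of Kramer's formula, i.e. THIS file), in the EXACT form needed at `p = 2`:

* `regulator_baseChange_eq_two_mul_regulator` — for a quadratic extension `K/F` of number fields and an
  elliptic curve `E/F` with `rank E(K) = rank E(F) = 1` and **no `K`-rational `2`-torsion**,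
  **`Reg(E/K) = 2 · Reg(E/F)`** (canonical heights relative to `K` resp. `F`, `ĥ_K = [K:F]·ĥ_F` on
  `F`-points, tree `canonicalHeight_baseChange`).

Proof.  Let `g` generate `E(F)/tors` and `g_K` generate `E(K)/tors`, `ι g ≡ k·g_K (mod tors)`.  The tree's
height–index relation `exists_mul_canonicalHeight_eq_index_sq_mul_regulator` (Kriz–Li 2019 file, Gross–Zagier
V.§2 bookkeeping: the conjugation `σ` acts as `+1` on `E(K)/tors ≅ ℤ`, `g_K + σ g_K ≡ 2 g_K` is `F`-rational,
so `k ∣ 2`) gives `k² ∈ {1, 4}`.  WITHOUT `2`-TORSION `k² = 4` is impossible: the torsion subgroup `T` of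
`E(K)` is then `2`-divisible (doubling is injective on the finite group `T`, hence onto), so
`ι g = ±2 g_K + t = 2R`; applying `σ` gives `2(σR − R) = 0`, hence `σR = R`, so `R = ι R'` is `F`-rational
(`mem_range_incl_of_map_conj_eq`) and `g = 2R'` in `E(F)`, contradicting that `g` generates `E(F)/tors`.
Hence `k = ±1`, `ĥ_K(g_K) = ĥ_K(ι g) = 2 ĥ_F(g)`, i.e. `Reg(E/K) = 2 Reg(E/F)`.  (With `2`-torsion the
factor can be `1/2`: e.g. `ι g = 2 g_K` happens for `E = 14a`-type curves; the hypothesis is sharp.)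

Used on the Ш-cell frame with `F = ℚ`, `W(ℚ)[2] = 0` (⟹ `W(K)[2] = 0` for quadratic `K`, tree
`forall_two_smul_eq_zero_baseChange_of_finrank_eq_two`), `rank W(ℚ) = 1`, `rank W^{(d_K)}(ℚ) = 0`
(⟹ `rank W(K) = 1`, tree `mordellWeilRank_baseChange_of_finrank_eq_two_of_finite`).
[cite: GrossZagierInvent1986, V.§2 (p. 311)] [cite: Kramer1981, Thm. 1]
-/

noncomputable section

open scoped Classical

namespace Summit.BirchSwinnertonDyer.BirchSwinnertonDyer.Theorems.GenusExact.ShaCell.Bookkeeping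

open WeierstrassCurve NumberField Literature.NumberTheory.EllipticCurves
open Literature.NumberTheory.EllipticCurves.KrizLi2019
open Literature.NumberTheory.QuadraticFields

variable {F : Type} [Field F] [NumberField F] (W : WeierstrassCurve F) [W.IsElliptic]
  (K : Type) [Field K] [NumberField K] [Algebra F K]

omit [NumberField F] in
/-- In an abelian group without `2`-torsion, a FINITE subgroup is `2`-divisible: every element of the
torsion subgroup of `E(K)` is twice a point (doubling is injective on the finite group, hence onto).
[folklore] -/
theorem exists_two_nsmul_eq_of_mem_torsion
    (hT : ∀ P : (W.baseChange K).toAffine.Point, (2 : ℕ) • P = 0 → P = 0)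
    {t : (W.baseChange K).toAffine.Point}
    (ht : t ∈ AddCommGroup.torsion (W.baseChange K).toAffine.Point) :
    ∃ t' : (W.baseChange K).toAffine.Point, (2 : ℕ) • t' = t := by
  haveI : (W.baseChange K).IsElliptic := isElliptic_baseChange' W K
  haveI : Finite (AddCommGroup.torsion (W.baseChange K).toAffine.Point) :=
    (W.baseChange K).finite_torsion_point
  set T := AddCommGroup.torsion (W.baseChange K).toAffine.Point
  have hinj : Function.Injective fun s : T => (2 : ℕ) • s := by
    intro a b hab
    have h2 : (2 : ℕ) • ((a : (W.baseChange K).toAffine.Point) - b) = 0 := by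
      have hab' : (((2 : ℕ) • a : T) : (W.baseChange K).toAffine.Point) = (((2 : ℕ) • b : T) : _) :=
        congrArg Subtype.val hab
      simp only [AddSubgroupClass.coe_nsmul] at hab'
      rw [smul_sub, hab', sub_self]
    exact Subtype.ext (sub_eq_zero.mp (hT _ h2))
  obtain ⟨s, hs⟩ := (Finite.surjective_of_injective hinj) ⟨t, ht⟩
  exact ⟨s, by simpa only [AddSubgroupClass.coe_nsmul] using congrArg Subtype.val hs⟩

/-- **The regulator doubles under a quadratic base change in rank one without `2`-torsion**: for a
quadratic extension `K/F` of number fields and `E/F` elliptic with `rank E(K) = rank E(F) = 1` and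
`E(K)[2] = 0`, `Reg(E/K) = 2 · Reg(E/F)` — the image of a generator of `E(F)/tors` generates `E(K)/tors`,
and `ĥ_K = 2 ĥ_F` on `F`-points.  The regulator term (`−rank E(K) = −1` in the exponent) of the
`2`-part of the Birch–Swinnerton-Dyer quotient under `K/ℚ` on a Ш-cell frame (LINE 41 stub ISO₂).
[cite: GrossZagierInvent1986, V.§2 (p. 311)] -/
theorem regulator_baseChange_eq_two_mul_regulator (h2 : Module.finrank F K = 2)
    (hrK : (W.baseChange K).mordellWeilRank = 1) (hrF : W.mordellWeilRank = 1)
    (hT : ∀ P : (W.baseChange K).toAffine.Point, (2 : ℕ) • P = 0 → P = 0) :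
    (W.baseChange K).regulator = 2 * W.regulator := by
  haveI : (W.baseChange K).IsElliptic := isElliptic_baseChange' W K
  haveI : NeZero (2 : F) := ⟨two_ne_zero⟩
  -- generators over `K` and over `F`
  obtain ⟨gK, hgK, hgenK, huniqK, hregK⟩ :=
    exists_generator_regulator_eq_of_mordellWeilRank_eq_one (W.baseChange K) hrK
  obtain ⟨g, hg, hgen, huniq, hreg⟩ := exists_generator_regulator_eq_of_mordellWeilRank_eq_one W hrF
  set T := AddCommGroup.torsion (W.baseChange K).toAffine.Point with hT_def
  set ι : W.toAffine.Point →+ (W.baseChange K).toAffine.Point := QuadraticDescent.incl K W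
    with hι_def
  -- the conjugation `σ` of `K/F` acting on `E(K)`
  obtain ⟨θ, c, hθ, hc⟩ := Quadratic.exists_sq_eq_algebraMap (F := F) (K := K) h2
  set σ : (W.baseChange K).toAffine.Point →+ (W.baseChange K).toAffine.Point :=
    Affine.Point.map (W' := W) (Quadratic.conj h2 hθ hc) with hσ_def
  have hσι : ∀ y : W.toAffine.Point, σ (ι y) = ι y := fun y =>
    Affine.Point.map_baseChange (W' := W) (Quadratic.conj h2 hθ hc) y
  -- `ĥ_K(ι g) = 2 ĥ_F(g)`
  have hhg2 : (ι g).canonicalHeight = 2 * g.canonicalHeight := by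
    have h := Affine.Point.canonicalHeight_baseChange (R := F) (K := F) (L := K) (W := W) g
    rw [h2] at h
    exact_mod_cast h
  -- `ι g ≡ k • gK (mod T)`, `k ≠ 0`
  obtain ⟨k, hk⟩ := hgenK (ι g)
  have hιg : ¬ IsOfFinAddOrder (ι g) := fun hfin =>
    hg ((Affine.Point.map_injective (W' := W) _).isOfFinAddOrder_iff.mp hfin)
  have hk0 : k ≠ 0 := by
    rintro rfl
    rw [zero_smul, sub_zero] at hk
    exact hιg ((AddCommGroup.mem_torsion _).mp hk)
  have hhk : (ι g).canonicalHeight = (k : ℝ) ^ 2 * gK.canonicalHeight :=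
    canonicalHeight_eq_of_sub_zsmul_mem_torsion (W.baseChange K) hk
  -- the height–index relation gives `k² ∈ {1, 4}`
  obtain ⟨m, hm, hmeq⟩ :=
    exists_mul_canonicalHeight_eq_index_sq_mul_regulator W K h2 hrK hrF (ι g) hιg
  have hidx : (AddSubgroup.zmultiples (ι g)).index = k.natAbs * (W.baseChange K).torsionOrder :=
    index_zmultiples_eq (W.baseChange K) hgK hgenK hk0 hk
  have hTpos : (0 : ℝ) < (W.baseChange K).torsionOrder := by
    exact_mod_cast (W.baseChange K).torsionOrder_pos_holds
  have hRpos : 0 < W.regulator := W.regulator_pos'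
  have hmk : (m : ℝ) = (k : ℝ) ^ 2 := by
    rw [hidx, hhg2, ← hreg] at hmeq
    push_cast at hmeq
    have hkabs : ((k.natAbs : ℕ) : ℝ) ^ 2 = (k : ℝ) ^ 2 := by
      rw [Nat.cast_natAbs, Int.cast_abs, sq_abs]
    have key : ((m : ℝ) - (k : ℝ) ^ 2) *
        (2 * ((W.baseChange K).torsionOrder : ℝ) ^ 2 * W.regulator) = 0 := by
      rw [mul_pow, hkabs] at hmeq
      linear_combination hmeq
    rcases mul_eq_zero.mp key with h | h
    · linarith
    · exfalso
      have : (0 : ℝ) < 2 * ((W.baseChange K).torsionOrder : ℝ) ^ 2 * W.regulator := by positivity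
      exact this.ne' h
  have hk2 : k ^ 2 = 1 ∨ k ^ 2 = 4 := by
    rcases hm with rfl | rfl
    · left; exact_mod_cast hmk.symm
    · right; exact_mod_cast hmk.symm
  -- WITHOUT `2`-torsion, `k² = 4` is impossible
  have hk1 : k ^ 2 = 1 := by
    rcases hk2 with h | h
    · exact h
    exfalso
    -- `k = 2s` with `s = ±1`
    obtain ⟨s, hs⟩ : ∃ s : ℤ, k = 2 * s := by
      have h' : k ^ 2 = 2 ^ 2 := by rw [h]; norm_num
      rcases sq_eq_sq_iff_eq_or_eq_neg.mp h' with e | e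
      · exact ⟨1, by rw [e]; ring⟩
      · exact ⟨-1, by rw [e]; ring⟩
    -- the torsion defect `t = ι g − k•gK` is twice a point
    obtain ⟨t', ht'⟩ := exists_two_nsmul_eq_of_mem_torsion W K hT hk
    -- so `ι g = 2 • R`
    set R : (W.baseChange K).toAffine.Point := s • gK + t' with hR
    have hιgR : ι g = (2 : ℕ) • R := by
      have e1 : ι g = k • gK + (2 : ℕ) • t' := by rw [ht']; abel
      rw [e1, hR, hs, smul_add, mul_smul, two_zsmul, two_nsmul, two_nsmul]
    -- `σ R = R`
    have hσR : σ R = R := by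
      have h1 : (2 : ℕ) • (σ R - R) = 0 := by
        rw [smul_sub, ← map_nsmul, ← hιgR, hσι, sub_self]
      exact sub_eq_zero.mp (hT _ h1)
    -- hence `R` is `F`-rational: `R = ι R'`, and `g = 2 • R'`
    obtain ⟨R', hR'⟩ := AddMonoidHom.mem_range.mp
      (mem_range_incl_of_map_conj_eq W K h2 hθ hc R hσR)
    have hg2 : g = (2 : ℕ) • R' := by
      apply QuadraticDescent.incl_injective (K := K) W
      change ι g = ι ((2 : ℕ) • R')
      rw [map_nsmul, hR', hιgR]
    -- contradiction with `g` generating `E(F)/tors`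
    obtain ⟨j, hj⟩ := hgen R'
    have hmem : (1 - 2 * j) • g ∈ AddCommGroup.torsion W.toAffine.Point := by
      have h2R : (2 : ℤ) • R' = g := by rw [two_zsmul, ← two_nsmul, ← hg2]
      have e2 : (1 - 2 * j) • g = (2 : ℤ) • (R' - j • g) := by
        rw [smul_sub, h2R, sub_smul, one_smul, mul_smul]
      rw [e2]
      exact AddSubgroup.zsmul_mem _ hj 2
    have := huniq (1 - 2 * j) hmem
    omega
  -- conclude: `ĥ_K(gK) = ĥ_K(ι g) = 2 ĥ_F(g)`
  rw [hregK, hreg]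
  have hk1R : (k : ℝ) ^ 2 = 1 := by exact_mod_cast hk1
  rw [hk1R, one_mul] at hhk
  rw [← hhk, hhg2]

/-- **The regulator term on a Ш-cell frame** (`F = ℚ`): for `W/ℚ` elliptic with `rank W(ℚ) = 1`, NO rational
`2`-torsion, and a quadratic field `K` whose twist `W^{(d_K)}` has rank `0`: **`Reg(W_K/K) = 2 · Reg(W/ℚ)`**
(`rank W(K) = rank W(ℚ) + rank W^{(d_K)}(ℚ) = 1`, Silverman Ex. 10.16, tree
`mordellWeilRank_baseChange_of_finrank_eq_two_of_finite`; `W(K)[2] = 0`, tree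
`PlusDescent.forall_two_smul_eq_zero_baseChange_of_finrank_eq_two`).  On the Ш-cell frame the two rank
hypotheses are GZK for `W` (`r_an = 1`) and for `W^{(d_K)}` (`L(W^{(d_K)},1) ≠ 0`).
[cite: GrossZagierInvent1986, V.§2 (p. 311)] [cite: SilvermanAEC2009, Exercise 10.16] -/
theorem regulator_baseChange_eq_two_mul_regulator_rat (W : WeierstrassCurve ℚ) [W.IsElliptic]
    (K : Type) [Field K] [NumberField K] (h2 : Module.finrank ℚ K = 2) (hr : W.mordellWeilRank = 1)
    (hrd : (W.quadraticTwist (NumberField.discr K : ℚ)).mordellWeilRank = 0)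
    (hT : ∀ P : W.toAffine.Point, (2 : ℕ) • P = 0 → P = 0) :
    (W.baseChange K).regulator = 2 * W.regulator := by
  haveI : (W.baseChange K).IsElliptic := isElliptic_baseChange' W K
  haveI : Module.Finite ℤ (W.baseChange K).toAffine.Point := (W.baseChange K).module_finite_point_holds
  have hrK : (W.baseChange K).mordellWeilRank = 1 := by
    rw [W.mordellWeilRank_baseChange_of_finrank_eq_two_of_finite K h2, hr, hrd]
  -- (`hT` restated on the `DecidableEq ℚ` instance used by the tree lemma; the instances are equal)
  have hT' := fun (Q : W.toAffine.Point)
      (hQ : @HSMul.hSMul ℕ W.toAffine.Point W.toAffine.Point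
        (@instHSMul ℕ W.toAffine.Point (@NSMul.toSMul W.toAffine.Point (@AddMonoid.toNSMul W.toAffine.Point
          (@SubNegMonoid.toAddMonoid W.toAffine.Point (@AddGroup.toSubNegMonoid W.toAffine.Point
            (@AddCommGroup.toAddGroup W.toAffine.Point
              (@Affine.Point.instAddCommGroup ℚ _ W.toAffine fun a b => Classical.propDecidable (a = b)))))))) 2 Q = 0) =>
    hT Q (by convert hQ using 9)
  exact regulator_baseChange_eq_two_mul_regulator W K h2 hrK hr
    (fun P hP => PlusDescent.forall_two_smul_eq_zero_baseChange_of_finrank_eq_two W K h2 two_ne_zero hT' P hP)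

end Summit.BirchSwinnertonDyer.BirchSwinnertonDyer.Theorems.GenusExact.ShaCell.Bookkeeping

end
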